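import Summits.BirchSwinnertonDyer.BirchSwinnertonDyer.Theorems.PrintCf2SplitBadTwoAvatarRigidity
import Summits.BirchSwinnertonDyer.Rank1Residual.X11b.Three.LambdaSupplyPadicUnits
import HarnessLib

/-!
# An avatar with `ℚ_p`-rational Frobenius values is `ℤ_pˣ`-valued
# (width brick O2′a, road α: the generic half of "the avatar of `(ψ∘c)⁻¹` is `ℤ₂ˣ`-valued")

Cell `bsd-print-cf2`, seat `bsd-line-cf2-p1-w4` g7, crux `stmt-BirchSwinnertonDyer-20368`
`PrintCf2.SplitBadTwoRankOneOfFacts`.  Theses-free; `--supports` the crux.  The input of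
`QuadraticPart.exists_v10_triple` (B11d-ii) is a continuous `χ : Γ_K →ₜ* ℤ₂ˣ` together with a framed
`r₀ : Γ_K → GL₁(ℚ̄₂)` with entries `χ(σ)` which is a `2`-adic avatar of `λ = (ψ∘c)⁻¹` (O2′).  THIS FILE
reduces O2′ to a statement about the VALUES of `λ`: for any number field `K` and any prime `p`,

* `forall_entry_mem_range_of_eventually` (`ℚ_p ⊆ ℚ̄_p` is closed — the tree's
  `LambdaSupply.isClosed_range_algebraMap_padicAlgCl`, inlined; if the Frobenius entries of a framed
  `r : Γ_K → GL₁(ℚ̄_p)` above all but finitely many places lie in `ℚ_p`, then EVERY `r(σ)₀₀` lies in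
  `ℚ_p` — Frobenius density `absoluteGaloisGroup.frobenius_dense` + closedness);
* **`exists_padicIntUnitsChar_of_forall_mem_range`**: a continuous `η : Γ_K →ₜ* ℚ̄_pˣ` with all values
  in `ℚ_p` IS `algebraMap ∘ χ` for a continuous `χ : Γ_K →ₜ* ℤ_pˣ` (values of a continuous character of
  the compact `Γ_K` have norm `1`, `LambdaSupply.PadicUnits.norm_apply_eq_one`; continuity through the
  closed embedding `ℚ_p → ℚ̄_p`);
* **`exists_padicIntUnitsChar_of_isPAdicAvatarOf`**: if `r` is a `p`-adic avatar of a Hecke character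
  `φ` whose values `ι⁻¹(φ(ϖ_v))` lie in `ℚ_p` for all but finitely many `v`, then `r(σ)₀₀ = χ(σ)` for a
  continuous `χ : Γ_K →ₜ* ℤ_pˣ` — exactly the `(χ, r₀)` input of `exists_v10_triple`.
So O2′ for road α is now: «`ι⁻¹((ψ∘c)(ϖ_w)) ∈ ℚ₂` for almost all `w`» (O2′b: `ψ` is Deuring's character
with values generating the primes of `K = ℚ(√−7)`, and `−7` is a `2`-adic square).

HONEST FRAMING: topological plumbing; closes nothing; beyond-print theorem: no.  BSD is not proved by
any of this.

References: [SerreAbelianLadic1968] Ch. I §2.2–2.3, Ch. III §2.3; [Washington1997] §5.1.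
-/

-- the summit namespace `Summit.BirchSwinnertonDyer.BirchSwinnertonDyer` repeats the problem name by design (D-0017)
set_option linter.dupNamespace false
set_option autoImplicit false

noncomputable section

open scoped Classical

open Polynomial NumberField IsDedekindDomain Field Filter Topology
  Literature.NumberTheory.EllipticCurves Literature.NumberTheory.GaloisRepresentations
open Summit.BirchSwinnertonDyer.Rank1Residual.X11b.Three.LambdaSupply

namespace Summit.BirchSwinnertonDyer.BirchSwinnertonDyer.Theorems.PrintCf2.AvatarRigidity

variable {K : Type} [Field K] [NumberField K] {p : ℕ} [hp : Fact p.Prime] (ι : PadicAlgCl p ≃+* ℂ)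

/-- **Frobenius density**: if the entries of `r : Γ_K → GL₁(ℚ̄_p)` at every arithmetic Frobenius above
all but finitely many places lie in `ℚ_p`, then every entry `r(σ)₀₀` lies in `ℚ_p` (the preimage of the
closed `ℚ_p` is closed and contains a dense set, `absoluteGaloisGroup.frobenius_dense`).
[cite: SerreAbelianLadic1968, Ch. I §2.2 Cor. 2 (a)] -/
theorem forall_entry_mem_range_of_eventually (r : FramedGaloisRep K (PadicAlgCl p) 1)
    (h : ∀ᶠ v : HeightOneSpectrum (𝓞 K) in cofinite,
      ∀ 𝔓 ∈ v.primesAbove, ∀ Φ : absoluteGaloisGroup K, IsArithFrobAt (𝓞 K) Φ 𝔓 →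
        (((r Φ : GL (Fin 1) (PadicAlgCl p)) : Matrix (Fin 1) (Fin 1) (PadicAlgCl p)) 0 0) ∈
          Set.range (algebraMap ℚ_[p] (PadicAlgCl p))) (σ : absoluteGaloisGroup K) :
    (((r σ : GL (Fin 1) (PadicAlgCl p)) : Matrix (Fin 1) (Fin 1) (PadicAlgCl p)) 0 0) ∈
      Set.range (algebraMap ℚ_[p] (PadicAlgCl p)) := by
  set S : Set (HeightOneSpectrum (𝓞 K)) := {v | ¬ ∀ 𝔓 ∈ v.primesAbove, ∀ Φ : absoluteGaloisGroup K,
    IsArithFrobAt (𝓞 K) Φ 𝔓 →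
      (((r Φ : GL (Fin 1) (PadicAlgCl p)) : Matrix (Fin 1) (Fin 1) (PadicAlgCl p)) 0 0) ∈
        Set.range (algebraMap ℚ_[p] (PadicAlgCl p))} with hS
  have hSf : S.Finite := Filter.eventually_cofinite.1 h
  have hdense := absoluteGaloisGroup.frobenius_dense
    Literature.NumberTheory.Automorphic.chebotarev_artinRep_holds K S hSf
  have h1 : Continuous fun τ : absoluteGaloisGroup K ↦
      ((r τ : GL (Fin 1) (PadicAlgCl p)) : Matrix (Fin 1) (Fin 1) (PadicAlgCl p)) :=
    Units.continuous_val.comp r.continuous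
  have hcont : Continuous fun τ : absoluteGaloisGroup K ↦
      (((r τ : GL (Fin 1) (PadicAlgCl p)) : Matrix (Fin 1) (Fin 1) (PadicAlgCl p)) 0 0) :=
    (continuous_apply 0).comp ((continuous_apply 0).comp h1)
  have hclosed : IsClosed {τ : absoluteGaloisGroup K |
      (((r τ : GL (Fin 1) (PadicAlgCl p)) : Matrix (Fin 1) (Fin 1) (PadicAlgCl p)) 0 0) ∈
        Set.range (algebraMap ℚ_[p] (PadicAlgCl p))} :=
    (algebraMap_isometry ℚ_[p] (PadicAlgCl p)).isClosedEmbedding.isClosed_range.preimage hcont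
  have hsub : {τ : absoluteGaloisGroup K | ∃ v ∉ S, ∃ 𝔓 ∈ v.primesAbove, IsArithFrobAt (𝓞 K) τ 𝔓} ⊆
      {τ | (((r τ : GL (Fin 1) (PadicAlgCl p)) : Matrix (Fin 1) (Fin 1) (PadicAlgCl p)) 0 0) ∈
        Set.range (algebraMap ℚ_[p] (PadicAlgCl p))} := by
    rintro τ ⟨v, hv, 𝔓, h𝔓, hτ⟩
    have hv' : ∀ 𝔓 ∈ v.primesAbove, ∀ Φ : absoluteGaloisGroup K, IsArithFrobAt (𝓞 K) Φ 𝔓 →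
        (((r Φ : GL (Fin 1) (PadicAlgCl p)) : Matrix (Fin 1) (Fin 1) (PadicAlgCl p)) 0 0) ∈
          Set.range (algebraMap ℚ_[p] (PadicAlgCl p)) := by
      by_contra hc
      exact hv hc
    exact hv' 𝔓 h𝔓 τ hτ
  have huniv : Set.univ ⊆ {τ : absoluteGaloisGroup K |
      (((r τ : GL (Fin 1) (PadicAlgCl p)) : Matrix (Fin 1) (Fin 1) (PadicAlgCl p)) 0 0) ∈
        Set.range (algebraMap ℚ_[p] (PadicAlgCl p))} := by
    rw [← hdense.closure_eq]
    exact hclosed.closure_subset_iff.mpr hsub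
  exact huniv (Set.mem_univ σ)

/-- **A continuous `ℚ̄_pˣ`-valued character of `Γ_K` with values in `ℚ_p` is `ℤ_pˣ`-valued**: there is a
continuous `χ : Γ_K →ₜ* ℤ_pˣ` with `η(σ) = χ(σ)` in `ℚ̄_p` (values of a continuous character of the
compact `Γ_K` have norm `1`; `ℚ_p → ℚ̄_p` is a closed embedding). [cite: SerreAbelianLadic1968, Ch. III §2.3]
[cite: Washington1997, §5.1] -/
theorem exists_padicIntUnitsChar_of_forall_mem_range (η : absoluteGaloisGroup K →ₜ* (PadicAlgCl p)ˣ)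
    (h : ∀ σ, ((η σ : (PadicAlgCl p)ˣ) : PadicAlgCl p) ∈ Set.range (algebraMap ℚ_[p] (PadicAlgCl p))) :
    ∃ χ : absoluteGaloisGroup K →ₜ* ℤ_[p]ˣ, ∀ σ, ((η σ : (PadicAlgCl p)ˣ) : PadicAlgCl p) =
      algebraMap ℚ_[p] (PadicAlgCl p) (((χ σ : ℤ_[p]ˣ) : ℤ_[p]) : ℚ_[p]) := by
  choose x hx using h
  have hinj : Function.Injective (algebraMap ℚ_[p] (PadicAlgCl p)) :=
    (algebraMap ℚ_[p] (PadicAlgCl p)).injective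
  -- `x` is a continuous homomorphism with values of norm one
  have hnorm : ∀ σ, ‖x σ‖ = 1 := fun σ ↦ by
    rw [← PadicAlgCl.norm_extends, hx σ]
    exact PadicUnits.norm_apply_eq_one (F := PadicAlgCl p) η.toMonoidHom η.continuous σ
  have hmul : ∀ σ τ, x (σ * τ) = x σ * x τ := fun σ τ ↦
    hinj (by rw [map_mul, hx, hx, hx, map_mul, Units.val_mul])
  have hone : x 1 = 1 := hinj (by rw [hx, map_one, map_one, Units.val_one])
  have hcont : Continuous x := by
    rw [(algebraMap_isometry ℚ_[p] (PadicAlgCl p)).isClosedEmbedding.continuous_iff]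
    have : (algebraMap ℚ_[p] (PadicAlgCl p)) ∘ x = fun σ ↦ ((η σ : (PadicAlgCl p)ˣ) : PadicAlgCl p) :=
      funext hx
    rw [this]
    exact Units.continuous_val.comp η.continuous
  -- the `ℤ_p`-valued lift and its unit structure
  let z : absoluteGaloisGroup K → ℤ_[p] := fun σ ↦ ⟨x σ, (hnorm σ).le⟩
  have hz : ∀ σ, ((z σ : ℤ_[p]) : ℚ_[p]) = x σ := fun _ ↦ rfl
  have hzc : Continuous z := hcont.subtype_mk _
  have hzmul : ∀ σ τ, z (σ * τ) = z σ * z τ := fun σ τ ↦ PadicInt.ext (by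
    rw [hz, PadicInt.coe_mul, hz, hz, hmul])
  have hzone : z 1 = 1 := PadicInt.ext (by rw [hz, hone, PadicInt.coe_one])
  have hzinv : ∀ σ, z σ * z σ⁻¹ = 1 := fun σ ↦ by rw [← hzmul, mul_inv_cancel, hzone]
  have hzinv' : ∀ σ, z σ⁻¹ * z σ = 1 := fun σ ↦ by rw [← hzmul, inv_mul_cancel, hzone]
  let χ₀ : absoluteGaloisGroup K →* ℤ_[p]ˣ :=
    { toFun := fun σ ↦ ⟨z σ, z σ⁻¹, hzinv σ, hzinv' σ⟩
      map_one' := Units.ext hzone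
      map_mul' := fun σ τ ↦ Units.ext (hzmul σ τ) }
  have hχ₀ : ∀ σ, ((χ₀ σ : ℤ_[p]ˣ) : ℤ_[p]) = z σ := fun _ ↦ rfl
  have hχ₀c : Continuous χ₀ := by
    refine Units.continuous_iff.mpr ⟨hzc, ?_⟩
    have : (fun σ ↦ (((χ₀ σ)⁻¹ : ℤ_[p]ˣ) : ℤ_[p])) = fun σ ↦ z σ⁻¹ := funext fun σ ↦ rfl
    rw [this]
    exact hzc.comp continuous_inv
  exact ⟨⟨χ₀, hχ₀c⟩, fun σ ↦ by rw [← hx σ]; rfl⟩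

/-- **An avatar with `ℚ_p`-rational Frobenius entries is `ℤ_pˣ`-valued**: for a framed
`r : Γ_K → GL₁(ℚ̄_p)` whose Frobenius entries above almost all places lie in `ℚ_p` there is a continuous
`χ : Γ_K →ₜ* ℤ_pˣ` with `r(σ)₀₀ = χ(σ)` for all `σ`. [cite: SerreAbelianLadic1968, Ch. I §2.3 and Ch. III §2.3] -/
theorem exists_padicIntUnitsChar_of_eventually (r : FramedGaloisRep K (PadicAlgCl p) 1)
    (h : ∀ᶠ v : HeightOneSpectrum (𝓞 K) in cofinite,
      ∀ 𝔓 ∈ v.primesAbove, ∀ Φ : absoluteGaloisGroup K, IsArithFrobAt (𝓞 K) Φ 𝔓 →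
        (((r Φ : GL (Fin 1) (PadicAlgCl p)) : Matrix (Fin 1) (Fin 1) (PadicAlgCl p)) 0 0) ∈
          Set.range (algebraMap ℚ_[p] (PadicAlgCl p))) :
    ∃ χ : absoluteGaloisGroup K →ₜ* ℤ_[p]ˣ, ∀ σ,
      (((r σ : GL (Fin 1) (PadicAlgCl p)) : Matrix (Fin 1) (Fin 1) (PadicAlgCl p)) 0 0) =
        algebraMap ℚ_[p] (PadicAlgCl p) (((χ σ : ℤ_[p]ˣ) : ℤ_[p]) : ℚ_[p]) := by
  have hall := forall_entry_mem_range_of_eventually r h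
  obtain ⟨χ, hχ⟩ := exists_padicIntUnitsChar_of_forall_mem_range (detChar r) fun σ ↦ by
    rw [coe_detChar_eq_entry]
    exact hall σ
  exact ⟨χ, fun σ ↦ by rw [← coe_detChar_eq_entry, hχ σ]⟩

/-- **O2′a.**  If `r` is a `p`-adic avatar of a Hecke character `φ` and `ι⁻¹(φ(ϖ_v)) ∈ ℚ_p` for all but
finitely many `v`, then `r` is `ℤ_pˣ`-valued: `r(σ)₀₀ = χ(σ)` for a continuous `χ : Γ_K →ₜ* ℤ_pˣ` — the
input `(χ, r₀)` of `QuadraticPart.exists_v10_triple`. [cite: SerreAbelianLadic1968, Ch. II §2.7, Ch. III §2.3] -/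
theorem exists_padicIntUnitsChar_of_isPAdicAvatarOf {φ : HeckeCharacter K}
    {r : FramedGaloisRep K (PadicAlgCl p) 1} (hr : IsPAdicAvatarOf ι φ r)
    (hφ : ∀ᶠ v : HeightOneSpectrum (𝓞 K) in cofinite,
      ι.symm (φ.valueAtUniformizer v) ∈ Set.range (algebraMap ℚ_[p] (PadicAlgCl p))) :
    ∃ χ : absoluteGaloisGroup K →ₜ* ℤ_[p]ˣ, ∀ σ,
      (((r σ : GL (Fin 1) (PadicAlgCl p)) : Matrix (Fin 1) (Fin 1) (PadicAlgCl p)) 0 0) =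
        algebraMap ℚ_[p] (PadicAlgCl p) (((χ σ : ℤ_[p]ˣ) : ℤ_[p]) : ℚ_[p]) := by
  refine exists_padicIntUnitsChar_of_eventually r
    ((hφ.and (eventually_notMem_and_isUnramifiedAt (p := p) φ)).mono fun v hv 𝔓 h𝔓 Φ hΦ ↦ ?_)
  obtain ⟨⟨y, hy⟩, hvp, hu⟩ := hv
  rw [entry_eq_of_isPAdicAvatarOf ι hr hvp hu 𝔓 h𝔓 Φ hΦ, ← hy, ← map_inv₀]
  exact ⟨y⁻¹, rfl⟩

end Summit.BirchSwinnertonDyer.BirchSwinnertonDyer.Theorems.PrintCf2.AvatarRigidity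

end
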